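import Literature.NumberTheory.LFunctions.VinogradovKorobovFarZerosMain
import Literature.NumberTheory.LFunctions.VinogradovKorobovKernelFacts
import Literature.NumberTheory.LFunctions.VinogradovKorobovIntermediateAssembly
import Literature.NumberTheory.LFunctions.VinogradovKorobovNearZeroCount
import Literature.NumberTheory.LFunctions.VinogradovKorobovLemma45
import Literature.NumberTheory.LFunctions.VinogradovKorobovFarZerosExplicit
import HarnessLib

/-!
# Lemma 4.7 of Mossinghoff–Trudgian–Yang from Ford's zero detector, Lemma 4.5 and (3.8)

Topic `Literature/NumberTheory/LFunctions`. Assembly file; everything here is PROVED, no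
definition and no named fact is introduced.

The named fact `Literature.NumberTheory.LFunctions.zero_inequality_mossinghoff_trudgian_yang`
(**Lemma 4.7** of Mossinghoff–Trudgian–Yang, *Res. Number Theory* 10 (2024) = arXiv:2212.06867,
for the polynomial `P₄₀`) was reduced in `VinogradovKorobovZeroDetector.lean`
(`zero_inequality_mossinghoff_trudgian_yang_of_detector_bound`: Ford's §7 assembly) to three
inputs: the smoothed zero detector with the far-zero bound inserted, MTY Lemma 4.4, and the
kernel facts. The last two are theorems of the tree (`mty_lemma_4_4'`,
`VinogradovKorobovTrigIntegral.lean`; `fordKernelFacts`, `VinogradovKorobovKernelFacts.lean`), and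
**MTY Lemma 4.6** (the far-zero bound) is now a theorem too, from (3.8) and MTY Lemma 4.5
(`FarZeros.mty_lemma_4_6_of_hsw`, `VinogradovKorobovFarZerosMain.lean`). Hence
`zero_inequality_mossinghoff_trudgian_yang_of_hsw`: **Lemma 4.7 follows from**

* `h42` — Ford's smoothed zero detector, **Ford 2002 Lemma 4.6 = MTY Lemma 4.2 with Lemma 4.3**,
  in the form a proof of it produces: for every bound `S` of the STRICT far-zero sum
  `Σ_{|1+it−ρ|>η}` (`FordFarZeroSumLT`; in Ford's Lemma 4.6 the zeros are partitioned into
  `|1+it−ρ| ≤ η` and its complement), `FordDetectorIneq A B η f D t S`, and `K(1) ≤ F(0) + 1.8D`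
  — it rests on Ford's Lemma 2.2 (zero detector via the Hadamard product), Lemma 4.5 (contour
  shift) and the tree's Lemmas 3.1, 3.3, 3.4;
* `h45` — **MTY Lemma 4.5** (`N(t, η) ≤ 1.3478 η^{3/2} B log t + 0.479 + (log A − log η +
  (2/3) log log t)/1.879`, `t ≥ 100`, `0 < η ≤ 1/4`), which rests on Ford's Lemma 4.1 (hence on
  Lemma 2.2) and the bound (4.2) of Ford for `Re (π/5) cot(πz/5)`;
* `h38` — **(3.8)**, the Riemann–von Mangoldt formula of Hasanalizade–Shen–Wong, the tree's
  named fact `zetaZeroCount_hasanalizade_shen_wong` (as a hypothesis; not restated).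

`zero_inequality_mossinghoff_trudgian_yang_of_hsw_with`: the same with the constant of Lemma 4.5 as
a parameter `c₄₅` (conclusion `zeroInequalityMTYWith (c₄₅ − 500/1879)`), for use with whatever
version of Lemma 4.5 gets proved (see the docstring: the printed `0.479` rests on a step of Ford's
Lemma 4.2 that Ford's Lemma 3.1 does not cover).

**With MTY Lemma 4.5 proved** (`mty_lemma_4_5`, `VinogradovKorobovLemma45.lean`, constant `3.777`;
Ford's (4.2) by a kernel-checked certificate, `VinogradovKorobovCotBound.lean`):
* `zero_inequality_mossinghoff_trudgian_yang_of_h42` — from `h42` and `h38` alone,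
  `zeroInequalityMTYWith (3.777 − 500/1879)`;
* `zero_inequality_mossinghoff_trudgian_yang_explicit_of_h42` — from `h42` ALONE,
  `zeroInequalityMTYGen 9.862 85.1 (3.777 − 500/1879)`: the zero-counting input is the tree's proved
  explicit theorem (`FarZeros.mty_lemma_4_6_explicit`, `VinogradovKorobovFarZerosExplicit.lean`)
  instead of (3.8), so no appeal to Platt's database remains; the three constants are what the
  printed argument yields with the tree's inputs.

## References

* M. J. Mossinghoff, T. S. Trudgian, A. Yang, arXiv:2212.06867, Lemmas 4.2–4.7, (3.8).
  (`MossinghoffTrudgianYangRNT2024`)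
* K. Ford, *Zero-free regions for the Riemann zeta function* (2002) = arXiv:1910.08205,
  Lemmas 4.1–4.6, 7.1. (`Ford2002Millennium`)
-/

noncomputable section

open Real

namespace Literature.NumberTheory.LFunctions

/-- **Lemma 4.7 of Mossinghoff–Trudgian–Yang from Ford's smoothed zero detector (strict far sums),
MTY Lemma 4.5 and (3.8).** [cite: MossinghoffTrudgianYangRNT2024, Lemma 4.7]
[cite: Ford2002Millennium, Lemma 7.1] -/
theorem zero_inequality_mossinghoff_trudgian_yang_of_hsw
    (h42 : ∀ A B : ℝ, 1 < A → 0 < B → RichertBound A B → ∀ η : ℝ, 0 < η → η ≤ 1 / 2 →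
      ∀ (f : ℝ → ℝ) (D : ℝ), IsFordSmoothing f η D →
        (∀ t : ℝ, 1000 ≤ t → ∀ S : ℝ, FordFarZeroSumLT t η S → FordDetectorIneq A B η f D t S) ∧
          (fordK f 1).re ≤ (fordLaplace f 0).re + 1.8 * D)
    (h45 : ∀ A B : ℝ, 1 < A → 0 < B → RichertBound A B → ∀ t u : ℝ, 100 ≤ t → 0 < u → u ≤ 1 / 4 →
      fordN t u ≤ 1.3478 * u ^ (3 / 2 : ℝ) * B * Real.log t + 0.479
        + (Real.log A - Real.log u + 2 / 3 * Real.log (Real.log t)) / 1.879)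
    (h38 : zetaZeroCount_hasanalizade_shen_wong) :
    zero_inequality_mossinghoff_trudgian_yang :=
  zero_inequality_mossinghoff_trudgian_yang_of_detector_bound
    (fun A B hA hB hR η hη hη4 f D hf ↦
      ⟨fun t ht ↦ (h42 A B hA hB hR η hη (by linarith) f D hf).1 t (by linarith) _
          fun T hT ↦ FarZeros.mty_lemma_4_6_of_hsw h38 hA hB (h45 A B hA hB hR) ht hη hη4 T hT,
        (h42 A B hA hB hR η hη (by linarith) f D hf).2⟩)
    mty_lemma_4_4' fun _ hθ hθ' ↦ fordKernelFacts hθ hθ'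

/-- **The same with the Lemma-4.5 constant as a parameter**: from Ford's smoothed zero detector
(strict far sums), a version of MTY Lemma 4.5 with constant `c₄₅ ≥ 0` in place of `0.479`, and
(3.8), the inequality of Lemma 4.7 with `0.213` replaced by `c₄₅ − 500/1879`
(`zeroInequalityMTYWith`; the named fact is the case `c₄₅ = 0.479` up to the rounding
`0.479 − 500/1879 ≤ 0.213`). Provided because the printed constant `0.479` of Lemma 4.5 rests on
Ford's Lemma 4.2, whose use of `|ζ'/ζ| ≤ 1/(3.1421R)` at `Re s = 1 + 0.6421R` is not covered by
Ford's Lemma 3.1 (which gives `1/(0.6421R)` there). [cite: MossinghoffTrudgianYangRNT2024, Lemma 4.7]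
[cite: Ford2002Millennium, Lemmas 4.2 and 7.1] -/
theorem zero_inequality_mossinghoff_trudgian_yang_of_hsw_with {c45 : ℝ} (hc45 : 0 ≤ c45)
    (h42 : ∀ A B : ℝ, 1 < A → 0 < B → RichertBound A B → ∀ η : ℝ, 0 < η → η ≤ 1 / 2 →
      ∀ (f : ℝ → ℝ) (D : ℝ), IsFordSmoothing f η D →
        (∀ t : ℝ, 1000 ≤ t → ∀ S : ℝ, FordFarZeroSumLT t η S → FordDetectorIneq A B η f D t S) ∧
          (fordK f 1).re ≤ (fordLaplace f 0).re + 1.8 * D)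
    (h45 : ∀ A B : ℝ, 1 < A → 0 < B → RichertBound A B → ∀ t u : ℝ, 100 ≤ t → 0 < u → u ≤ 1 / 4 →
      fordN t u ≤ 1.3478 * u ^ (3 / 2 : ℝ) * B * Real.log t + c45
        + (Real.log A - Real.log u + 2 / 3 * Real.log (Real.log t)) / 1.879)
    (h38 : zetaZeroCount_hasanalizade_shen_wong) :
    zeroInequalityMTYWith (c45 - 500 / 1879) :=
  zero_inequality_mossinghoff_trudgian_yang_of_detector_bound_with (c45 - 500 / 1879)
    (fun A B hA hB hR η hη hη4 f D hf ↦
      ⟨fun t ht ↦ (h42 A B hA hB hR η hη (by linarith) f D hf).1 t (by linarith) _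
          fun T hT ↦ FarZeros.mty_lemma_4_6_with h38 hA hB hc45 (h45 A B hA hB hR) ht hη hη4 T hT,
        (h42 A B hA hB hR η hη (by linarith) f D hf).2⟩)
    mty_lemma_4_4' fun _ hθ hθ' ↦ fordKernelFacts hθ hθ'

/-- **Lemma 4.7 of Mossinghoff–Trudgian–Yang from Ford's analytic inputs, with the constant that
Ford's argument yields**: from Ford's smoothed zero detector (`h42`, strict far sums), Ford's
Lemma 4.1 (`h41 : FordLemma41 A B` for the constants of (3.1)), Ford's (4.2) (the bound
`Re (π/5)cot(πz/5) ≥ 0.3758` on `U`) and (3.8), the inequality of Lemma 4.7 with `0.213` replaced by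
`3.777 − 500/1879` (`zeroInequalityMTYWith`), via `mty_lemma_4_5_of_ford41`
(`VinogradovKorobovNearZeroCount.lean`, which explains why `3.777` and not the printed `0.479`).
[cite: MossinghoffTrudgianYangRNT2024, Lemma 4.7] [cite: Ford2002Millennium, Lemmas 4.1, 4.2 and 7.1] -/
theorem zero_inequality_mossinghoff_trudgian_yang_of_ford41
    (h42 : ∀ A B : ℝ, 1 < A → 0 < B → RichertBound A B → ∀ η : ℝ, 0 < η → η ≤ 1 / 2 →
      ∀ (f : ℝ → ℝ) (D : ℝ), IsFordSmoothing f η D →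
        (∀ t : ℝ, 1000 ≤ t → ∀ S : ℝ, FordFarZeroSumLT t η S → FordDetectorIneq A B η f D t S) ∧
          (fordK f 1).re ≤ (fordLaplace f 0).re + 1.8 * D)
    (h41 : ∀ A B : ℝ, 1 < A → 0 < B → RichertBound A B → FordLemma41 A B)
    (hcot : ∀ z : ℂ, 0.6421 ≤ z.re → ‖z - 0.6421‖ ≤ 1 →
      0.3758 ≤ (((π / 5 : ℝ) : ℂ) * Complex.cot (((π / 5 : ℝ) : ℂ) * z)).re)
    (h38 : zetaZeroCount_hasanalizade_shen_wong) :
    zeroInequalityMTYWith (3.777 - 500 / 1879) :=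
  zero_inequality_mossinghoff_trudgian_yang_of_hsw_with (by norm_num) h42
    (fun A B hA hB hR _ _ ht hu hu4 ↦ mty_lemma_4_5_of_ford41 hB.le (h41 A B hA hB hR) hcot ht hu hu4)
    h38

/-- **Lemma 4.7 of Mossinghoff–Trudgian–Yang from Ford's smoothed zero detector and (3.8) alone,
with the constant that Ford's argument yields.** With MTY Lemma 4.5 now PROVED (`mty_lemma_4_5`,
`VinogradovKorobovLemma45.lean`: Ford's Lemma 4.1 from the tree's zero detector, Ford's (4.2) by a
kernel-checked certificate, constant `3.777`), MTY Lemma 4.6 proved from (3.8)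
(`FarZeros.mty_lemma_4_6_with`), MTY Lemma 4.4 (`mty_lemma_4_4'`) and the kernel facts
(`fordKernelFacts`), the inequality of Lemma 4.7 with `0.213` replaced by `3.777 − 500/1879`
(`zeroInequalityMTYWith (3.777 − 500/1879)`) follows from exactly two inputs:
`h42` — Ford's Lemma 4.6 (the smoothed zero detector with strict far sums, for the constants of
(3.1) with `A > 6.5`, the range of the fact) — and `h38` — the zero-counting bound (3.8) of
Hasanalizade–Shen–Wong (`zetaZeroCount_hasanalizade_shen_wong`). On the constant: the printed
`0.213` rests on MTY Lemma 4.5's printed `0.479`, whose printed proof bounds `ζ'/ζ` at the wrong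
abscissa (see `VinogradovKorobovNearZeroCount.lean`); `3.777 − 500/1879 = 3.5109…` is what the
printed argument proves.
[cite: MossinghoffTrudgianYangRNT2024, Lemma 4.7] [cite: Ford2002Millennium, Lemmas 4.6 and 7.1] -/
theorem zero_inequality_mossinghoff_trudgian_yang_of_h42
    (h42 : ∀ A B : ℝ, 6.5 < A → 0 < B → RichertBound A B → ∀ η : ℝ, 0 < η → η ≤ 1 / 2 →
      ∀ (f : ℝ → ℝ) (D : ℝ), IsFordSmoothing f η D →
        (∀ t : ℝ, 1000 ≤ t → ∀ S : ℝ, FordFarZeroSumLT t η S → FordDetectorIneq A B η f D t S) ∧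
          (fordK f 1).re ≤ (fordLaplace f 0).re + 1.8 * D)
    (h38 : zetaZeroCount_hasanalizade_shen_wong) :
    zeroInequalityMTYWith (3.777 - 500 / 1879) :=
  zero_inequality_mossinghoff_trudgian_yang_of_detector_bound_with' (3.777 - 500 / 1879)
    (fun A B hA hB hR η hη hη4 f D hf ↦
      ⟨fun t ht ↦ (h42 A B hA hB hR η hη (by linarith) f D hf).1 t (by linarith) _
          fun T hT ↦ FarZeros.mty_lemma_4_6_with h38 (by linarith) hB (by norm_num)
            (fun t u ht hu hu4 ↦ mty_lemma_4_5 (by linarith) hB.le hR ht hu hu4) ht hη hη4 T hT,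
        (h42 A B hA hB hR η hη (by linarith) f D hf).2⟩)
    mty_lemma_4_4' fun _ hθ hθ' ↦ fordKernelFacts hθ hθ'

/-- **Lemma 4.7 of Mossinghoff–Trudgian–Yang with every input proved except Ford's smoothed zero
detector, and with the constants these proofs yield.** From `h42` alone — Ford's Lemma 4.6 (the
smoothed zero detector with strict far sums, for the constants of (3.1) with `A > 6.5`) — the
inequality of Lemma 4.7 holds with `(5.409, 209.1, 0.213)` replaced by
`(9.862, 85.1, 3.777 − 500/1879)` (`zeroInequalityMTYGen 9.862 85.1 (3.777 − 500/1879)`):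
the zero-counting input is the tree's explicit theorem `abs_zetaZeroCount_sub_main_le_explicit`
(slope `0.3083`; `FarZeros.mty_lemma_4_6_explicit`) instead of (3.8), MTY Lemma 4.5 is
`mty_lemma_4_5` (constant `3.777`, see `VinogradovKorobovNearZeroCount.lean` on the printed
`0.479`), MTY Lemma 4.4 is `mty_lemma_4_4'`, the kernel facts are `fordKernelFacts`, and the
assembly is `zero_inequality_mossinghoff_trudgian_yang_of_detector_bound_gen`. No appeal to
(3.8)/Platt's database remains. [cite: MossinghoffTrudgianYangRNT2024, Lemma 4.7]
[cite: Ford2002Millennium, Lemmas 4.6 and 7.1] -/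
theorem zero_inequality_mossinghoff_trudgian_yang_explicit_of_h42
    (h42 : ∀ A B : ℝ, 6.5 < A → 0 < B → RichertBound A B → ∀ η : ℝ, 0 < η → η ≤ 1 / 2 →
      ∀ (f : ℝ → ℝ) (D : ℝ), IsFordSmoothing f η D →
        (∀ t : ℝ, 1000 ≤ t → ∀ S : ℝ, FordFarZeroSumLT t η S → FordDetectorIneq A B η f D t S) ∧
          (fordK f 1).re ≤ (fordLaplace f 0).re + 1.8 * D) :
    zeroInequalityMTYGen 9.862 85.1 (3.777 - 500 / 1879) :=
  zero_inequality_mossinghoff_trudgian_yang_of_detector_bound_gen 9.862 82.7 85.1 (3.777 - 500 / 1879)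
    (by norm_num) (by norm_num)
    (fun A B hA hB hR η hη hη4 f D hf ↦
      ⟨fun t ht ↦ (h42 A B hA hB hR η hη (by linarith) f D hf).1 t (by linarith) _
          fun T hT ↦ FarZeros.mty_lemma_4_6_explicit (by linarith) hB (by norm_num)
            (fun t u ht hu hu4 ↦ mty_lemma_4_5 (by linarith) hB.le hR ht hu hu4) ht hη hη4 T hT,
        (h42 A B hA hB hR η hη (by linarith) f D hf).2⟩)
    mty_lemma_4_4' fun _ hθ hθ' ↦ fordKernelFacts hθ hθ'

end Literature.NumberTheory.LFunctions
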